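import Summits.ResolutionOfSingularities.KangarooAtlas.MizutaniPBasis
import Summits.ResolutionOfSingularities.KangarooAtlas.MizutaniPTowerFin
import Summits.ResolutionOfSingularities.KangarooAtlas.MizutaniLemma29Field
import HarnessLib

/-!
# `k` is a finite root tower over the complement field `k^{p^e}(Λ ∖ b)` of a `p`-basis

Cell `pub-rosobs`, Mizutani enclosure (seat mizutani-encloser-2, gen 9).  AI-written; *AI review is weaker than expert review*;
NOT a resolution-of-singularities theorem (summit relevance C).

Second step of the route to Mizutani's Lemma 2.4 / 2.7 over fields of INFINITE `p`-degree (seat HANDOFF § PLAN): for a finite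
`p`-independent family `b : Fin s → k` and a `p`-basis `Λ ⊇ range b` of `k` (`MizutaniPBasis.exists_pBasis_superset`), the
COMPLEMENT FIELD `G_e := k^{p^e}(Λ ∖ range b)` contains `k^{p^e}`, and `k = G_e(b)` is a ROOT TOWER of order `p^e` over `G_e` with the
finitely many generators `b` — `IsRootTower G_e k (p^e) (b^{p^e}) b` in the sense of `MizutaniRootTower`.  Consequently the Hasse–Schmidt
operators `h.hsD T : k →ₗ[G_e] k` of this tower are `k^{p^e}`-linear operators ON `k` extending the operators `D^{(T)}` of the finite tower
`k^{p^e}(b)` — the «operator extension» that encloser-1's proof of Lemma 2.4 needs beyond finite `p`-degree.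

* `fmon_append` (box monomials of a concatenated family multiply), `mem_span_fmon_of_mem_towerField` (elements of `k^{p^e}(μ)` are
  `k^{p^e}`-combinations of box monomials of `μ`);
* **`linearIndependent_fmon_adjoin_diff`** — the box monomials `b^W`, `W ∈ [0, p^e)^s`, are linearly independent over `G_e`
  (coefficients live in `k^{p^e}(μ)` for a finite `μ ⊂ Λ ∖ b`; `(b, μ)` is a finite subfamily of `Λ`, hence `p`-independent);
* `adjoin_complement_eq_top` (`k = G_e(b)`), `span_fmon_complement_eq_top` (the `b^W` span `k` over `G_e`), `finrank_complement`
  (`[k : G_e] = (p^e)^s`);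
* **`isRootTower_complement`**, **`exists_isRootTower_of_pIndep`** — `k` is a root tower of order `p^e` over `G_e ⊇ k^{p^e}` with generators `b`.

References: [Mizutani1973HironakaGroupSchemes] Lemma 2.4 (p. 88: K = k^q(c_1, …, c_m) inside k = k^q(Λ)); Bourbaki, Algèbre V §13 [folklore].
-/

noncomputable section

open MvPolynomial Literature.AlgebraicGeometry.Resolution.HironakaScheme

namespace Summit.ResolutionOfSingularities.KangarooAtlas.Mizutani

universe u

section PBasisTower

variable {k : Type u} [Field k] {p : ℕ} [hp : Fact p.Prime] [CharP k p]

omit hp [CharP k p] in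
/-- Box monomials of a concatenated family: `(b, μ)^{(W, W')} = b^W · μ^{W'}`. [folklore] -/
theorem fmon_append {s t q : ℕ} (b : Fin s → k) (μ : Fin t → k) (W : Fin s → Fin q) (W' : Fin t → Fin q) :
    fmon (Fin.append b μ) (Fin.append W W') = fmon b W * fmon μ W' := by
  unfold fmon
  rw [Fin.prod_univ_add]
  congr 1
  · exact Finset.prod_congr rfl fun i _ => by rw [Fin.append_left, Fin.append_left]
  · exact Finset.prod_congr rfl fun i _ => by rw [Fin.append_right, Fin.append_right]

/-- Elements of the finite tower `k^{p^e}(μ)` are `k^{p^e}`-linear combinations of the box monomials `μ^W`, `W ∈ [0,p^e)^t`. [folklore] -/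
theorem mem_span_fmon_of_mem_towerField (e : ℕ) {t : ℕ} (μ : Fin t → k) {z : k} (hz : z ∈ towerField e μ) :
    z ∈ Submodule.span (frobPow k p e) (Set.range fun W : Fin t → Fin (p ^ e) => fmon μ W) := by
  classical
  letI : SMul (frobPow k p e) (RootTower (frobPow k p e) (towerPow e μ) (p ^ e)) := Algebra.toSMul
  obtain ⟨w, hw⟩ := liftHom_surjective e μ ⟨z, hz⟩
  obtain ⟨P, rfl⟩ := Ideal.Quotient.mk_surjective w
  obtain ⟨c, hc⟩ := Submodule.mem_span_range_iff_exists_fun (R := frobPow k p e).mp (mk_mem_span_box e μ P)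
  have hterm : ∀ W : Fin t → Fin (p ^ e), (towerField e μ).val (liftHom (towerGen e μ) (towerGen_pow e μ)
      (c W • Ideal.Quotient.mk (rootIdeal (frobPow k p e) (towerPow e μ) (p ^ e)) (monomial (Box.toF W) 1))) =
      c W • fmon μ W := by
    intro W
    rw [map_smul, map_smul, liftHom_mk, IntermediateField.coe_val, coe_aeval_monomial]
    simp only [OneMemClass.coe_one, one_mul, Box.toF_apply, Subfield.smul_def, smul_eq_mul]
    rfl
  have hz' : z = (towerField e μ).val (liftHom (towerGen e μ) (towerGen_pow e μ)
      (Ideal.Quotient.mk (rootIdeal (frobPow k p e) (towerPow e μ) (p ^ e)) P)) := by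
    rw [hw, IntermediateField.val_mk]
  rw [hz', ← hc, map_sum, map_sum]
  refine Submodule.sum_mem _ fun W _ => ?_
  rw [hterm]
  exact Submodule.smul_mem _ _ (Submodule.subset_span ⟨W, rfl⟩)

/-- **The box monomials of `b` are linearly independent over the complement field `k^{p^e}(Λ ∖ b)`** (`Λ ⊇ range b` a `p`-basis in the
finite-subfamily sense, `e ≥ 1`): a relation has coefficients in `k^{p^e}(μ)` for a finite `μ ⊂ Λ ∖ b`, i.e. is a `k^{p^e}`-relation among the
box monomials of the finite `p`-independent family `(b, μ)`. [cite: Mizutani1973HironakaGroupSchemes, Lemma 2.4 (p. 88)] -/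
theorem linearIndependent_fmon_adjoin_diff {Λ : Set k}
    (hΛ : ∀ (m : ℕ) (g : Fin m → k), Function.Injective g → Set.range g ⊆ Λ → PIndep p 1 g)
    {s : ℕ} {b : Fin s → k} (hbi : Function.Injective b) (hbΛ : Set.range b ⊆ Λ) {e : ℕ} (he : 1 ≤ e) :
    LinearIndependent (IntermediateField.adjoin (frobPow k p e) (Λ \ Set.range b))
      (fun W : Fin s → Fin (p ^ e) => fmon b W) := by
  classical
  set G := IntermediateField.adjoin (frobPow k p e) (Λ \ Set.range b) with hG
  refine Fintype.linearIndependent_iff.mpr fun g hg W₀ => ?_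
  -- a common finite envelope `μ ⊂ Λ ∖ b` of the coefficients
  have hfin : ∀ W : Fin s → Fin (p ^ e), ∃ T : Finset k, (T : Set k) ⊆ Λ \ Set.range b ∧
      ((g W : G) : k) ∈ IntermediateField.adjoin (frobPow k p e) (T : Set k) :=
    fun W => IntermediateField.exists_finset_of_mem_adjoin (g W).2
  choose T hT hgT using hfin
  set U : Finset k := Finset.univ.biUnion T with hU
  have hUΛ : (U : Set k) ⊆ Λ \ Set.range b := by
    intro x hx
    rw [hU, Finset.coe_biUnion] at hx
    obtain ⟨W, -, hxW⟩ := Set.mem_iUnion₂.mp hx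
    exact hT W hxW
  set t := U.card with ht
  set μ : Fin t → k := fun j => ((U.equivFin.symm j : U) : k) with hμ
  have hμinj : Function.Injective μ := fun j j' h => U.equivFin.symm.injective (Subtype.ext h)
  have hμU : Set.range μ = (U : Set k) := by
    ext x
    constructor
    · rintro ⟨j, rfl⟩; exact (U.equivFin.symm j).2
    · intro hx; exact ⟨U.equivFin ⟨x, hx⟩, by rw [hμ]; dsimp only; rw [Equiv.symm_apply_apply]⟩
  have hgμ : ∀ W, ((g W : G) : k) ∈ towerField e μ := fun W => by
    unfold towerField
    rw [hμU]
    exact IntermediateField.adjoin.mono _ _ _ (by rw [hU]; exact Finset.subset_biUnion_of_mem T (Finset.mem_univ W))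
      (hgT W)
  -- expand every coefficient in the box monomials of `μ`
  have hcoef : ∀ W, ∃ l : (Fin t → Fin (p ^ e)) → frobPow k p e, ∑ W', l W' • fmon μ W' = ((g W : G) : k) :=
    fun W => (Submodule.mem_span_range_iff_exists_fun (R := frobPow k p e)).mp
      (mem_span_fmon_of_mem_towerField e μ (hgμ W))
  choose l hl using hcoef
  -- the concatenated family `(b, μ)` is a finite subfamily of `Λ`, hence `p`-independent at level `e`
  set B : Fin (s + t) → k := Fin.append b μ with hB
  have hBinj : Function.Injective B := by
    intro i j hij
    induction i using Fin.addCases with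
    | left i =>
      induction j using Fin.addCases with
      | left j => rw [hB, Fin.append_left, Fin.append_left] at hij; rw [hbi hij]
      | right j =>
        rw [hB, Fin.append_left, Fin.append_right] at hij
        exact absurd ⟨i, hij⟩ ((hUΛ (hμU ▸ ⟨j, rfl⟩ : μ j ∈ (U : Set k))).2)
    | right i =>
      induction j using Fin.addCases with
      | left j =>
        rw [hB, Fin.append_right, Fin.append_left] at hij
        exact absurd ⟨j, hij.symm⟩ ((hUΛ (hμU ▸ ⟨i, rfl⟩ : μ i ∈ (U : Set k))).2)
      | right j => rw [hB, Fin.append_right, Fin.append_right] at hij; rw [hμinj hij]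
  have hBΛ : Set.range B ⊆ Λ := by
    rintro _ ⟨i, rfl⟩
    induction i using Fin.addCases with
    | left i => rw [hB, Fin.append_left]; exact hbΛ ⟨i, rfl⟩
    | right i => rw [hB, Fin.append_right]; exact (hUΛ (hμU ▸ ⟨i, rfl⟩ : μ i ∈ (U : Set k))).1
  have hBind : PIndep p e B := (hΛ (s + t) B hBinj hBΛ).of_one e he
  -- reindex by pairs `(W, W')`
  set ι : (Fin s → Fin (p ^ e)) × (Fin t → Fin (p ^ e)) → (Fin (s + t) → Fin (p ^ e)) :=
    fun WW => Fin.append WW.1 WW.2 with hι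
  have hιinj : Function.Injective ι := by
    rintro ⟨W₁, W₁'⟩ ⟨W₂, W₂'⟩ h
    have h1 : W₁ = W₂ := funext fun i => by
      have := congrFun h (Fin.castAdd t i)
      simp only [hι, Fin.append_left] at this
      exact this
    have h2 : W₁' = W₂' := funext fun i => by
      have := congrFun h (Fin.natAdd s i)
      simp only [hι, Fin.append_right] at this
      exact this
    rw [h1, h2]
  have hpair : LinearIndependent (frobPow k p e)
      (fun WW : (Fin s → Fin (p ^ e)) × (Fin t → Fin (p ^ e)) => fmon B (ι WW)) := hBind.comp ι hιinj
  -- the given relation, read over `k^{p^e}`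
  have hrel : ∑ WW : (Fin s → Fin (p ^ e)) × (Fin t → Fin (p ^ e)), l WW.1 WW.2 • fmon B (ι WW) = 0 := by
    have hg' : ∑ W, ((g W : G) : k) * fmon b W = 0 := by
      have := hg
      simp only [IntermediateField.smul_def, smul_eq_mul] at this
      exact this
    rw [Fintype.sum_prod_type]
    simp only [hι, hB, fmon_append, Subfield.smul_def, smul_eq_mul]
    rw [← hg']
    refine Finset.sum_congr rfl fun W _ => ?_
    rw [← hl W, Finset.sum_mul]
    refine Finset.sum_congr rfl fun W' _ => ?_
    rw [Subfield.smul_def, smul_eq_mul]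
    ring
  have hl0 := Fintype.linearIndependent_iff.mp hpair (fun WW => l WW.1 WW.2) hrel
  have hgW₀ : ((g W₀ : G) : k) = 0 := by
    rw [← hl W₀]
    exact Finset.sum_eq_zero fun W' _ => by rw [hl0 (W₀, W')]; exact zero_smul _ _
  exact_mod_cast hgW₀

/-- **`k = G_e(b)`** for the complement field `G_e = k^{p^e}(Λ ∖ b)` of a `p`-basis `Λ ⊇ range b` (`k = k^{p^e}(Λ) = k^{p^e}(Λ ∖ b)(b)`).
[cite: Mizutani1973HironakaGroupSchemes, Lemma 2.4 (p. 88)] -/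
theorem adjoin_complement_eq_top {Λ : Set k} (htop : IntermediateField.adjoin (frobPow k p 1) Λ = ⊤)
    {s : ℕ} {b : Fin s → k} (hbΛ : Set.range b ⊆ Λ) (e : ℕ) :
    IntermediateField.adjoin (IntermediateField.adjoin (frobPow k p e) (Λ \ Set.range b)) (Set.range b) = ⊤ := by
  rw [← IntermediateField.restrictScalars_eq_top_iff (K := frobPow k p e), IntermediateField.adjoin_adjoin_left,
    Set.sdiff_union_of_subset hbΛ]
  exact adjoin_frobPow_pBasis_eq_top htop e

/-- The generators are integral over the complement field (`b_i^{p^e} ∈ k^{p^e} ⊆ G_e`). [folklore] -/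
theorem isIntegral_complement {e : ℕ} (G : IntermediateField (frobPow k p e) k) {s : ℕ} (b : Fin s → k) (i : Fin s) :
    IsIntegral G (b i) := by
  refine ⟨Polynomial.X ^ p ^ e - Polynomial.C ⟨b i ^ p ^ e, G.algebraMap_mem ⟨b i ^ p ^ e, pow_mem_frobPow e (b i)⟩⟩,
    Polynomial.monic_X_pow_sub_C _ (pow_ne_zero e hp.out.ne_zero), ?_⟩
  rw [Polynomial.eval₂_sub, Polynomial.eval₂_X_pow, Polynomial.eval₂_C, sub_eq_zero]
  rfl

/-- `k = G_e[b]` as a `G_e`-algebra (the generators are algebraic). [folklore] -/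
theorem algebraAdjoin_complement_eq_top {Λ : Set k} (htop : IntermediateField.adjoin (frobPow k p 1) Λ = ⊤)
    {s : ℕ} {b : Fin s → k} (hbΛ : Set.range b ⊆ Λ) (e : ℕ) :
    Algebra.adjoin (IntermediateField.adjoin (frobPow k p e) (Λ \ Set.range b)) (Set.range b) = ⊤ := by
  rw [← IntermediateField.adjoin_toSubalgebra_of_isAlgebraic
    (fun y hy => by obtain ⟨i, rfl⟩ := hy; exact (isIntegral_complement _ b i).isAlgebraic),
    adjoin_complement_eq_top htop hbΛ e, IntermediateField.top_toSubalgebra]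

/-- **The box monomials `b^W` span `k` over the complement field `G_e`** (`k = G_e[b]` and `b_i^{p^e} ∈ G_e` reduces exponents).
[cite: Mizutani1973HironakaGroupSchemes, Lemma 2.4 (p. 88)] -/
theorem span_fmon_complement_eq_top {Λ : Set k} (htop : IntermediateField.adjoin (frobPow k p 1) Λ = ⊤)
    {s : ℕ} {b : Fin s → k} (hbΛ : Set.range b ⊆ Λ) (e : ℕ) :
    Submodule.span (IntermediateField.adjoin (frobPow k p e) (Λ \ Set.range b))
      (Set.range fun W : Fin s → Fin (p ^ e) => fmon b W) = ⊤ := by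
  classical
  set G := IntermediateField.adjoin (frobPow k p e) (Λ \ Set.range b) with hG
  set V := Submodule.span G (Set.range fun W : Fin s → Fin (p ^ e) => fmon b W) with hV
  have hq : 0 < p ^ e := pow_pos hp.out.pos e
  -- `V` is stable under multiplication by each generator
  have hgen : ∀ (i : Fin s), ∀ v ∈ V, b i * v ∈ V := by
    intro i v hv
    induction hv using Submodule.span_induction with
    | mem x hx =>
      obtain ⟨W, rfl⟩ := hx
      have hsplit : ∀ W' : Fin s → Fin (p ^ e), fmon b W' = b i ^ (W' i : ℕ) * ∏ l ∈ Finset.univ \ {i}, b l ^ (W' l : ℕ) :=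
        fun W' => by unfold fmon; exact Finset.prod_eq_mul_prod_sdiff_singleton_of_mem (Finset.mem_univ i) _
      have hrest : ∀ (v : Fin (p ^ e)), ∏ l ∈ Finset.univ \ {i}, b l ^ ((Function.update W i v) l : ℕ) =
          ∏ l ∈ Finset.univ \ {i}, b l ^ (W l : ℕ) := fun v =>
        Finset.prod_congr rfl fun l hl => by
          rw [Function.update_of_ne (Finset.notMem_singleton.mp (Finset.mem_sdiff.mp hl).2)]
      by_cases hlt : (W i : ℕ) + 1 < p ^ e
      · -- raise the exponent at `i`
        have : b i * fmon b W = fmon b (Function.update W i ⟨(W i : ℕ) + 1, hlt⟩) := by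
          rw [hsplit W, hsplit (Function.update W i _), hrest, Function.update_self, pow_succ]
          ring
        rw [this]
        exact Submodule.subset_span ⟨_, rfl⟩
      · -- wrap around: `b_i^{p^e} ∈ G_e`
        have hWi : (W i : ℕ) + 1 = p ^ e := by have := (W i).2; omega
        have hmem : b i ^ p ^ e ∈ G := G.algebraMap_mem ⟨b i ^ p ^ e, pow_mem_frobPow e (b i)⟩
        have : b i * fmon b W = (⟨b i ^ p ^ e, hmem⟩ : G) • fmon b (Function.update W i ⟨0, hq⟩) := by
          rw [IntermediateField.smul_def, smul_eq_mul, hsplit W, hsplit (Function.update W i _), hrest, Function.update_self]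
          dsimp only
          rw [pow_zero, one_mul, show b i ^ p ^ e = b i ^ ((W i : ℕ) + 1) by rw [hWi], pow_succ]
          ring
        rw [this]
        exact Submodule.smul_mem _ _ (Submodule.subset_span ⟨_, rfl⟩)
    | zero => rw [mul_zero]; exact Submodule.zero_mem _
    | add x y _ _ hx hy => rw [mul_add]; exact Submodule.add_mem _ hx hy
    | smul c x _ hx => rw [mul_smul_comm]; exact Submodule.smul_mem _ _ hx
  have hone : (1 : k) ∈ V := by
    have : fmon b (fun _ => (⟨0, hq⟩ : Fin (p ^ e))) = 1 := by unfold fmon; simp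
    rw [← this]; exact Submodule.subset_span ⟨_, rfl⟩
  -- hence `V` absorbs the whole algebra `G_e[b] = k`
  have halg : Algebra.adjoin G (Set.range b) = ⊤ := algebraAdjoin_complement_eq_top htop hbΛ e
  have habs : ∀ x ∈ Algebra.adjoin G (Set.range b), ∀ v ∈ V, x * v ∈ V := by
    intro x hx
    induction hx using Algebra.adjoin_induction with
    | mem x hx => obtain ⟨i, rfl⟩ := hx; exact hgen i
    | algebraMap r => intro v hv; rw [Algebra.algebraMap_eq_smul_one, smul_mul_assoc, one_mul]; exact Submodule.smul_mem _ _ hv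
    | add x y _ _ hx hy => intro v hv; rw [add_mul]; exact Submodule.add_mem _ (hx v hv) (hy v hv)
    | mul x y _ _ hx hy => intro v hv; rw [mul_assoc]; exact hx _ (hy v hv)
  rw [eq_top_iff]
  intro z _
  have hz : z ∈ Algebra.adjoin G (Set.range b) := by rw [halg]; trivial
  have := habs z hz 1 hone
  rwa [mul_one] at this

/-- **`k` IS A ROOT TOWER OF ORDER `p^e` OVER THE COMPLEMENT FIELD `G_e = k^{p^e}(Λ ∖ b)`** with generators `b`:
`G_e[Y_1, …, Y_s]/(Y_i^{p^e} − b_i^{p^e}) ≅ k` (`Λ ⊇ range b` a `p`-basis, `e ≥ 1`).  Its Hasse–Schmidt operators `h.hsD T : k →ₗ[G_e] k` extend the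
operators `D^{(T)}` of the finite tower `k^{p^e}(b)` to `k^{p^e}`-linear operators on `k`. [cite: Mizutani1973HironakaGroupSchemes, Lemma 2.4 (p. 88)] -/
theorem isRootTower_complement {Λ : Set k}
    (hΛ : ∀ (m : ℕ) (g : Fin m → k), Function.Injective g → Set.range g ⊆ Λ → PIndep p 1 g)
    (htop : IntermediateField.adjoin (frobPow k p 1) Λ = ⊤)
    {s : ℕ} {b : Fin s → k} (hbi : Function.Injective b) (hbΛ : Set.range b ⊆ Λ) {e : ℕ} (he : 1 ≤ e) :
    IsRootTower (IntermediateField.adjoin (frobPow k p e) (Λ \ Set.range b)) k (p ^ e)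
      (fun i => ⟨b i ^ p ^ e, (IntermediateField.adjoin (frobPow k p e) (Λ \ Set.range b)).algebraMap_mem
        ⟨b i ^ p ^ e, pow_mem_frobPow e (b i)⟩⟩) b := by
  classical
  set G := IntermediateField.adjoin (frobPow k p e) (Λ \ Set.range b) with hG
  have hli := linearIndependent_fmon_adjoin_diff hΛ hbi hbΛ he
  have hsp := span_fmon_complement_eq_top htop hbΛ e
  let B : Module.Basis (Fin s → Fin (p ^ e)) G k := Module.Basis.mk hli hsp.ge
  haveI : FiniteDimensional G k := Module.Finite.of_basis B
  have hdim : Module.finrank G k = (p ^ e) ^ s := by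
    rw [Module.finrank_eq_card_basis B, Fintype.card_fun, Fintype.card_fin, Fintype.card_fin]
  have halg : Algebra.adjoin G (Set.range b) = ⊤ := algebraAdjoin_complement_eq_top htop hbΛ e
  exact isRootTower_of_adjoin_eq_top (pow_pos hp.out.pos e) (fun i => rfl) halg hdim

/-- **EVERY FINITE `p`-INDEPENDENT FAMILY PRESENTS `k` AS A FINITE ROOT TOWER OVER A SUBFIELD CONTAINING `k^{p^e}`**: for `b` with
`PIndep p 1 b` and `e ≥ 1` there is an intermediate field `k^{p^e} ⊆ G ⊆ k` with `IsRootTower G k (p^e) (b^{p^e}) b`.  (Take `G = k^{p^e}(Λ ∖ b)`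
for a `p`-basis `Λ ⊇ b`, `exists_pBasis_superset`.)  The tower's `G`-linear Hasse–Schmidt operators are the `k^{p^e}`-linear extensions to
`k` of the operators of the finite tower `k^{p^e}(b)`. [cite: Mizutani1973HironakaGroupSchemes, Lemma 2.4 (p. 88)] -/
theorem exists_isRootTower_of_pIndep {s : ℕ} {b : Fin s → k} (hb : PIndep p 1 b) {e : ℕ} (he : 1 ≤ e) :
    ∃ (G : IntermediateField (frobPow k p e) k) (x : Fin s → G),
      (∀ i, ((x i : G) : k) = b i ^ p ^ e) ∧ IsRootTower G k (p ^ e) x b := by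
  obtain ⟨Λ, hbΛ, hΛ, htop⟩ := exists_pBasis_superset hb
  exact ⟨_, _, fun i => rfl, isRootTower_complement hΛ htop (hb.injective_of_one_le le_rfl) hbΛ he⟩

end PBasisTower

end Summit.ResolutionOfSingularities.KangarooAtlas.Mizutani

end
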